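import Summits.Ventures.PercRepro.ProfilePointedMirrorUpset
import Summits.Ventures.PercRepro.ProfileBiIndepFlatSup

/-!
# PercRepro — THE BRIDGES: (PM-flat) ⟺ (H-gen) (`SepMirror`) ⟹ (H) ⟹ the per-point form of Theorem A (p10, gen 26)

`SepMirror` (ProfilePointedMirrorUpset, the separated-set form of (H-gen)) and `UpsetMirror` (ProfileBiIndepFlatSup, the
closure form) are the same statement (`sepMirror_iff_upsetMirror`, by `sepCount_le_mirror_iff_upCount_le`), so the matching
conjecture (PM-flat) `BiIndepFlatSup` is equivalent to `SepMirror` (`biIndepFlatSup_iff_sepMirror`) and implies (H) at every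
modular cut (`capMirror_of_flatSup`) and the per-point form of Theorem A (`biIndepPointed_of_flatSup`).  Nothing here asserts
(PM-flat), (H-gen) or (H).
-/

open scoped Matroid

namespace PercRepro.Cogirth

open Finset ThmH Skew

variable {α : Type} [DecidableEq α]

/-- The two forms of (H-gen) for every up-set are one statement. -/
theorem sepMirror_iff_upsetMirror : SepMirror α ↔ UpsetMirror α := by
  constructor
  · intro h M _ U hU k hk
    have h1 := h M U hU k hk
    have h2 := sepCount_le_mirror_iff_upCount_le (M := M) U (k := k) (by omega)
    unfold upCount at h2
    exact h2.1 h1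
  · intro h M _ U hU k hk
    have h1 := h M U hU k hk
    have h2 := sepCount_le_mirror_iff_upCount_le (M := M) U (k := k) (by omega)
    unfold upCount at h2
    exact h2.2 h1

/-- **(PM-flat) ⟺ (H-gen)** in the separated-set form. -/
theorem biIndepFlatSup_iff_sepMirror : BiIndepFlatSup α ↔ SepMirror α :=
  biIndepFlatSup_iff_forall_upset.trans sepMirror_iff_upsetMirror.symm

/-- (PM-flat) ⟹ (H) at every modular cut. -/
theorem capMirror_of_flatSup (h : BiIndepFlatSup α) : CapMirror α :=
  capMirror_of_sepMirror (biIndepFlatSup_iff_sepMirror.1 h)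

/-- (PM-flat) ⟹ the per-point form `out_k ≤ in_{k+1}` of Theorem A. -/
theorem biIndepPointed_of_flatSup (h : BiIndepFlatSup α) : BiIndepPointed α :=
  biIndepPointed_iff_capMirror.2 (capMirror_of_flatSup h)

end PercRepro.Cogirth
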